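import Summits.AnomalousDissipation.AnomalousDissipation.Theorems.MomentParityQuarticGateBasis
import Literature.Analysis.FluidPDE.GalerkinFlow
import Literature.Analysis.FluidPDE.NSHopfLimit
import Literature.Analysis.FluidPDE.StokesTorusDomainProofs
import Literature.Analysis.FunctionSpaces.TorusHNegOnePairing

/-!
# Route MomentParity · `GalerkinEnsembleRealization` — the Foias–Prodi generator on band-limited
  fields is the Galerkin vector field (Fourier side)

For the level-`N` Galerkin system of the Navier–Stokes equations on `T³` (frequency ball
`S = freqBall N`, steady force `f`, `galerkinRHS`, `NSGalerkinFourier`) and a band-limited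
`U ∈ H` (coefficients supported in `0 < |k|² ≤ N²`), the tested generator
`⟨F(U), g⟩ = (f, g) + ν (U, Δg) + ∫ (U⊗U) : ∇g` (`Torus.nsGeneratorPairing`, all derivatives on
the smooth solenoidal test field) against a band-limited `g` is the coefficient pairing
`∑_{k∈S} Re ⟪galerkinRHS(Û|_S) k, ĝ k⟫` (`nsGeneratorPairing_eq_sum_re_inner_galerkinRHS`), and the
Parseval frame of `P_N H` (`Torus.frameFieldIdx`) reconstructs the Galerkin vector field from these
pairings (`sum_nsGeneratorPairing_smul_fourierRestrict`): the Fourier form of the route's remark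
"on such measures the Foias–Prodi generator pairing IS the Galerkin generator"
(Foias–Manley–Rosa–Temam 2001, Ch. IV App. B; stmt-AnomalousDissipation-11466).
-/

noncomputable section

set_option linter.dupNamespace false

open MeasureTheory Set Filter Topology Function
open scoped BigOperators InnerProductSpace RealInnerProductSpace

namespace Summit.AnomalousDissipation.AnomalousDissipation.Theorems.MomentParity

open Literature.Analysis.FunctionSpaces Literature.Analysis.FunctionSpaces.Torus
open Literature.Analysis.FluidPDE Literature.Analysis.FluidPDE.Torus

/-- Local notation: the flat three-torus. -/
local notation "𝕋3" => UnitAddTorus (Fin 3)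
/-- Local notation: velocity values. -/
local notation "E3" => EuclideanSpace ℝ (Fin 3)
/-- Local notation: the `L²` space of velocity fields. -/
local notation "L2" => Lp (EuclideanSpace ℝ (Fin 3)) 2 (volume : Measure (UnitAddTorus (Fin 3)))

/-- The Fourier coefficients of a real field (shorthand used in statements). -/
local notation "𝓕" v => UnitAddTorus.mFourierCoeff (EuclideanSpace.complexify ∘ v)

/-! ### Band tests and coefficient pairings -/

/-- A field band-limited to `0 < |k|² ≤ N²` is band-limited to the ball `|k|² ≤ N²`. -/
theorem band_of_band₀ {N : ℕ} {g : 𝕋3 → E3}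
    (hg : ∀ k ∉ (freqBall N).erase (0 : Fin 3 → ℤ), (𝓕 g) k = 0) :
    ∀ k ∉ freqBall N, (𝓕 g) k = 0 := fun k hk =>
  hg k fun h => hk (Finset.mem_of_mem_erase h)

/-- **The `L²` pairing with a band test is a finite coefficient pairing**:
`(v, g) = ∑_{|k|² ≤ N²} Re ⟪v̂ k, ĝ k⟫` for `v ∈ L²` and `g ∈ L²` band-limited to the ball. -/
theorem pairing_eq_sum_re_inner {N : ℕ} (v : L2) {g : 𝕋3 → E3} (hg2 : MemLp g 2 volume)
    (hg : ∀ k ∉ freqBall N, (𝓕 g) k = 0) :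
    Torus.pairing v g = ∑ k ∈ freqBall N, (inner ℂ ((𝓕 (v : 𝕋3 → E3)) k) ((𝓕 g) k)).re :=
  integral_inner_eq_sum_of_band_limited (Lp.memLp v) hg2 hg

/-- **Frame reconstruction in coefficients**: for `U ∈ H` and `|k|² ≤ N²`,
`∑_p (U, e_p) ê_p(k) = Û(k)` over the Parseval frame `e_p` of `P_N H` (Fourier coefficients of
the pointwise identity `P_N U = ∑_p (U, e_p) e_p`). -/
theorem sum_pairing_smul_mFourierCoeff_frameFieldIdx (N : ℕ) (U : Torus.energySpace (Fin 3))
    {k : Fin 3 → ℤ} (hk : k ∈ freqBall N) :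
    ∑ p : Torus.FrameIdx (Fin 3) N,
        (Torus.pairing U.1 (Torus.frameFieldIdx N p) : ℂ) • (𝓕 (Torus.frameFieldIdx N p)) k =
      (𝓕 (U.1 : 𝕋3 → E3)) k := by
  have hptw := MomentParityQuarticGate.fourierTruncate_eq_sum_frameFieldIdx N U
  have heq : fourierTruncate N (U.1 : 𝕋3 → E3) =
      fun x => ∑ p : Torus.FrameIdx (Fin 3) N,
        Torus.pairing U.1 (Torus.frameFieldIdx N p) • Torus.frameFieldIdx N p x := funext hptw
  have h1 : (𝓕 (fourierTruncate N (U.1 : 𝕋3 → E3))) k = (𝓕 (U.1 : 𝕋3 → E3)) k := by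
    rw [fourierTruncate_eq, mFourierCoeff_realTrigPoly neg_mem_freqBall_of_mem
      (isConjSymm_mFourierCoeff ((Lp.memLp U.1).integrable one_le_two)), if_pos hk]
  rw [← h1, heq, MomentParityQuarticGate.mFourierCoeff_complexify_sum_smul Finset.univ _
    (fun p => (MomentParityQuarticGate.frameFieldIdx_band N p).1.continuous)]

/-! ### The generator on band-limited fields -/

/-- The coefficient vector `Û|_S` of any `U ∈ H` lies in the Galerkin phase space (real and
divergence free). -/
theorem fourierRestrict_coe_mem_galerkinSubspace (N : ℕ) (U : Torus.energySpace (Fin 3)) :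
    fourierRestrict (freqBall N) (U.1 : 𝕋3 → E3) ∈ galerkinSubspace (freqBall N) := by
  refine ⟨isRealCoeff_mFourierCoeff ((Lp.memLp U.1).integrable one_le_two), fun k => ?_⟩
  exact (isWeaklyDivFree_of_mem_energySpace U.2).sum_mul_mFourierCoeff_eq_zero (Lp.memLp U.1) k

/-- **A band-limited `U ∈ H` is a.e. the real trigonometric polynomial of its coefficients.** -/
theorem coe_ae_eq_realTrigPoly {N : ℕ} (U : Torus.energySpace (Fin 3))
    (hU : ∀ k ∉ (freqBall N).erase (0 : Fin 3 → ℤ), (𝓕 (U.1 : 𝕋3 → E3)) k = 0) :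
    (U.1 : 𝕋3 → E3) =ᵐ[volume]
      realTrigPoly (freqBall N) (coeffExt (freqBall N) (fourierRestrict (freqBall N) (U.1 : 𝕋3 → E3))) := by
  refine Torus.ae_eq_of_mFourierCoeff_complexify_eq (Lp.memLp U.1) (memLp_realTrigPoly _ _ 2) fun k => ?_
  rw [mFourierCoeff_realTrigPoly neg_mem_freqBall_of_mem
    ((fourierRestrict_coe_mem_galerkinSubspace N U).1.isConjSymm_coeffExt neg_mem_freqBall_of_mem)]
  by_cases hk : k ∈ freqBall N
  · rw [if_pos hk, coeffExt_of_mem _ hk, fourierRestrict_apply]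
  · rw [if_neg hk, band_of_band₀ hU k hk]

/-- **The Foias–Prodi generator against a band test is the Galerkin vector field paired with its
coefficients**: for `U ∈ H` band-limited to `0 < |k|² ≤ N²`, a smooth divergence-free band test
`g` and `f ∈ L²`, `⟨F(U), g⟩ = ∑_{|k|² ≤ N²} Re ⟪galerkinRHS(f̂|_S, Û|_S) k, ĝ k⟫`
(`Torus.nsGeneratorPairing_eq_flux` on the trigonometric representative, the master identity
`Torus.sum_re_inner_galerkinField_test`, and `(P_N f, g) = (f, g)`). -/
theorem nsGeneratorPairing_eq_sum_re_inner_galerkinField {N : ℕ} (ν : ℝ) {f : 𝕋3 → E3}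
    (hf : MemLp f 2 volume) (U : Torus.energySpace (Fin 3))
    (hU : ∀ k ∉ (freqBall N).erase (0 : Fin 3 → ℤ), (𝓕 (U.1 : 𝕋3 → E3)) k = 0)
    {g : 𝕋3 → E3} (hgs : Torus.IsSmooth g) (hgd : Torus.IsDivFree g)
    (hg : ∀ k ∉ freqBall N, (𝓕 g) k = 0) :
    nsGeneratorPairing ν f U g =
      ∑ k ∈ freqBall N, (inner ℂ (galerkinField ν (freqBall N)
        (coeffExt (freqBall N) (fourierRestrict (freqBall N) f))
        (coeffExt (freqBall N) (fourierRestrict (freqBall N) (U.1 : 𝕋3 → E3))) k) ((𝓕 g) k)).re := by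
  have hS : ∀ k ∈ freqBall (d := Fin 3) N, -k ∈ freqBall (d := Fin 3) N := neg_mem_freqBall_of_mem
  have hcV := fourierRestrict_coe_mem_galerkinSubspace N U
  have hcsymm : IsConjSymm (coeffExt (freqBall N) (fourierRestrict (freqBall N) (U.1 : 𝕋3 → E3))) :=
    hcV.1.isConjSymm_coeffExt hS
  have hcT : IsTransversal (freqBall N) (coeffExt (freqBall N) (fourierRestrict (freqBall N) (U.1 : 𝕋3 → E3))) :=
    hcV.2.isTransversal_coeffExt
  have hgr : IsRealCoeff (fourierRestrict (freqBall N) f) := isRealCoeff_mFourierCoeff (hf.integrable one_le_two)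
  have hgsymm : IsConjSymm (coeffExt (freqBall N) (fourierRestrict (freqBall N) f)) :=
    hgr.isConjSymm_coeffExt hS
  set w := realTrigPoly (freqBall N) (coeffExt (freqBall N) (fourierRestrict (freqBall N) (U.1 : 𝕋3 → E3)))
    with hwdef
  have hw : IsSmooth w := isSmooth_realTrigPoly _ _
  have hw2 : MemLp w 2 volume := memLp_realTrigPoly _ _ 2
  -- integrability of the three fluxes
  have hi1 : Integrable (fun x => ⟪w x, Torus.convect w g x⟫) volume := integrable_inner_convect_self hw2 hgs
  have hi2 : Integrable (fun x => ν * ⟪w x, laplacian g x⟫) volume :=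
    (integrable_inner_of_continuous (hw2.integrable one_le_two) hgs.laplacian.continuous).const_mul ν
  have hi3 : Integrable (fun x => ⟪f x, g x⟫) volume :=
    integrable_inner_of_continuous (hf.integrable one_le_two) hgs.continuous
  have hi3' : Integrable (fun x => ⟪fourierTruncate N f x, g x⟫) volume :=
    integrable_inner_of_continuous ((memLp_realTrigPoly _ _ 2).integrable one_le_two) hgs.continuous
  have hforce : ∫ x, ⟪fourierTruncate N f x, g x⟫ = ∫ x, ⟪f x, g x⟫ :=
    integral_inner_fourierTruncate_eq hf (hgs.memLp 2) hg
  calc nsGeneratorPairing ν f U g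
      = ∫ x, (⟪w x, Torus.convect w g x⟫ + ν * ⟪w x, laplacian g x⟫ + ⟪f x, g x⟫) :=
        nsGeneratorPairing_eq_flux ν hf hgs (coe_ae_eq_realTrigPoly U hU)
    _ = (∫ x, (⟪w x, Torus.convect w g x⟫ + ν * ⟪w x, laplacian g x⟫)) + ∫ x, ⟪f x, g x⟫ :=
        integral_add (hi1.add hi2) hi3
    _ = (∫ x, (⟪w x, Torus.convect w g x⟫ + ν * ⟪w x, laplacian g x⟫)) +
          ∫ x, ⟪fourierTruncate N f x, g x⟫ := by rw [hforce]
    _ = ∫ x, (⟪w x, Torus.convect w g x⟫ + ν * ⟪w x, laplacian g x⟫ + ⟪fourierTruncate N f x, g x⟫) :=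
        (integral_add (hi1.add hi2) hi3').symm
    _ = _ := by
        rw [hwdef, ← realTrigPoly_coeffExt_fourierRestrict N f,
          sum_re_inner_galerkinField_test ν hS hgsymm hcsymm hcT hgs hgd hg]

/-! ### The zero mode and the frame reconstruction of the Galerkin field -/

/-- **The convection symbol has no mean mode on transversal coefficients**: for `l + m = 0` the
amplitude `c_l · m = -(l · c_l) = 0`. -/
theorem convectionCoeff_zero_of_isTransversal {S : Finset (Fin 3 → ℤ)} {c : (Fin 3 → ℤ) → EuclideanSpace ℂ (Fin 3)}
    (hc : IsTransversal S c) (c' : (Fin 3 → ℤ) → EuclideanSpace ℂ (Fin 3)) :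
    convectionCoeff S c c' 0 = 0 := by
  rw [convectionCoeff_def]
  refine Finset.sum_eq_zero fun l hl => Finset.sum_eq_zero fun m _ => ?_
  split_ifs with hlm
  · have hm : m = -l := by
      have h' : l + m = 0 := hlm
      linear_combination h'
    subst hm
    have h0 : ∑ j, c l j * ((-l) j : ℂ) = 0 := by
      have h := hc l hl
      calc ∑ j, c l j * ((-l) j : ℂ) = -∑ j, ((l j : ℂ)) * c l j := by
            rw [← Finset.sum_neg_distrib]
            refine Finset.sum_congr rfl fun j _ => ?_
            simp only [Pi.neg_apply, Int.cast_neg]; ring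
        _ = 0 := by rw [h, neg_zero]
    rw [h0, mul_zero, zero_smul]
  · rfl

/-- **The Galerkin field of a mean-zero force has no mean mode** on the phase space:
`galerkinRHS(f̂|_S, c)(0) = f̂(0) - (convection)₀ = 0` for `∫ f = 0` and `c` transversal. -/
theorem galerkinRHS_apply_zero {N : ℕ} (ν : ℝ) {f : 𝕋3 → E3} (hfi : Integrable f volume)
    (hf0 : Torus.HasZeroMean f) {c : ↥(freqBall (d := Fin 3) N) → EuclideanSpace ℂ (Fin 3)}
    (hc : c ∈ galerkinSubspace (freqBall N)) :
    galerkinRHS (freqBall N) ν (fourierRestrict (freqBall N) f) c ⟨0, zero_mem_freqBall N⟩ = 0 := by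
  rw [galerkinRHS_apply, galerkinField_def]
  simp only [freqNormSq_zero, mul_zero, Complex.ofReal_zero, zero_smul, neg_zero, zero_add,
    leraySym_zero_freq]
  rw [convectionCoeff_zero_of_isTransversal hc.2.isTransversal_coeffExt, sub_zero,
    coeffExt_of_mem _ (zero_mem_freqBall N), fourierRestrict_apply]
  exact mFourierCoeff_complexify_zero_of_hasZeroMean hfi hf0

/-- The `L²` class of the real trigonometric polynomial with phase-space coefficients `w`,
`w(0) = 0`, lies in `H`, and its Fourier coefficients are `w` on the ball and `0` off it. -/
theorem toLp_realTrigPoly_mem_energySpace {N : ℕ} {w : ↥(freqBall (d := Fin 3) N) → EuclideanSpace ℂ (Fin 3)}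
    (hw : w ∈ galerkinSubspace (freqBall N)) (hw0 : w ⟨0, zero_mem_freqBall N⟩ = 0) :
    (memLp_realTrigPoly (freqBall N) (coeffExt (freqBall N) w) 2).toLp _ ∈ energySpace (Fin 3) ∧
      ∀ k, (𝓕 (((memLp_realTrigPoly (freqBall N) (coeffExt (freqBall N) w) 2).toLp _ : L2) : 𝕋3 → E3)) k =
        coeffExt (freqBall N) w k := by
  have hS : ∀ k ∈ freqBall (d := Fin 3) N, -k ∈ freqBall (d := Fin 3) N := neg_mem_freqBall_of_mem
  have hsymm : IsConjSymm (coeffExt (freqBall N) w) := hw.1.isConjSymm_coeffExt hS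
  have hcoef : ∀ k, (𝓕 (((memLp_realTrigPoly (freqBall N) (coeffExt (freqBall N) w) 2).toLp _ : L2) :
      𝕋3 → E3)) k = coeffExt (freqBall N) w k := by
    intro k
    rw [mFourierCoeff_congr_ae ((MemLp.coeFn_toLp _).fun_comp EuclideanSpace.complexify) k,
      mFourierCoeff_realTrigPoly hS hsymm]
    by_cases hk : k ∈ freqBall N
    · rw [if_pos hk]
    · rw [if_neg hk, coeffExt_of_not_mem _ hk]
  refine ⟨mem_energySpace_of_mFourierCoeff ?_ fun k => ?_, hcoef⟩
  · rw [hcoef, coeffExt_of_mem _ (zero_mem_freqBall N), hw0]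
  · rw [hcoef]
    by_cases hk : k ∈ freqBall N
    · rw [coeffExt_of_mem _ hk]; exact hw.2 ⟨k, hk⟩
    · simp [coeffExt_of_not_mem _ hk]

/-- **Frame reconstruction of a phase-space vector with no mean mode**: for `w` real, transversal,
`w(0) = 0`, `∑_p (∑_{|k|²≤N²} Re⟪w̄ k, ê_p k⟫) ê_p(k) = w̄(k)` for every `|k|² ≤ N²` (the frame
identity `P_N v = ∑_p (v, e_p) e_p` for `v = ` the trigonometric polynomial of `w`, in coefficients). -/
theorem sum_sum_re_inner_smul_mFourierCoeff_frameFieldIdx {N : ℕ}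
    {w : ↥(freqBall (d := Fin 3) N) → EuclideanSpace ℂ (Fin 3)}
    (hw : w ∈ galerkinSubspace (freqBall N)) (hw0 : w ⟨0, zero_mem_freqBall N⟩ = 0)
    {k : Fin 3 → ℤ} (hk : k ∈ freqBall N) :
    ∑ p : Torus.FrameIdx (Fin 3) N,
        ((∑ k' ∈ freqBall N, (inner ℂ (coeffExt (freqBall N) w k') ((𝓕 (Torus.frameFieldIdx N p)) k')).re : ℝ) : ℂ) •
          (𝓕 (Torus.frameFieldIdx N p)) k = coeffExt (freqBall N) w k := by
  obtain ⟨hv, hcoef⟩ := toLp_realTrigPoly_mem_energySpace hw hw0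
  have h := sum_pairing_smul_mFourierCoeff_frameFieldIdx N ⟨_, hv⟩ hk
  simp only at h
  rw [hcoef] at h
  rw [← h]
  refine Finset.sum_congr rfl fun p _ => ?_
  congr 2
  rw [pairing_eq_sum_re_inner _ ((MomentParityQuarticGate.frameFieldIdx_band N p).1.memLp 2)
    (band_of_band₀ (MomentParityQuarticGate.frameFieldIdx_band N p).2.2.2)]
  exact Finset.sum_congr rfl fun k' _ => by rw [hcoef]

/-- **The frame reconstructs the Galerkin vector field from the tested generators**: for a
mean-zero force `f ∈ L²` and a band-limited `U ∈ H`,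
`∑_p ⟨F(U), e_p⟩ ê_p|_S = galerkinRHS(f̂|_S, Û|_S)` in the Galerkin phase space — the Fourier form of
"on band-limited fields the Foias–Prodi generator IS the Galerkin generator". -/
theorem sum_nsGeneratorPairing_smul_fourierRestrict {N : ℕ} (ν : ℝ) {f : 𝕋3 → E3}
    (hf : MemLp f 2 volume) (hf0 : Torus.HasZeroMean f) (U : Torus.energySpace (Fin 3))
    (hU : ∀ k ∉ (freqBall N).erase (0 : Fin 3 → ℤ), (𝓕 (U.1 : 𝕋3 → E3)) k = 0) :
    ∑ p : Torus.FrameIdx (Fin 3) N, nsGeneratorPairing ν f U (Torus.frameFieldIdx N p) •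
        fourierRestrict (freqBall N) (Torus.frameFieldIdx N p) =
      galerkinRHS (freqBall N) ν (fourierRestrict (freqBall N) f)
        (fourierRestrict (freqBall N) (U.1 : 𝕋3 → E3)) := by
  have hS : ∀ k ∈ freqBall (d := Fin 3) N, -k ∈ freqBall (d := Fin 3) N := neg_mem_freqBall_of_mem
  set w := galerkinRHS (freqBall N) ν (fourierRestrict (freqBall N) f)
    (fourierRestrict (freqBall N) (U.1 : 𝕋3 → E3)) with hwdef
  have hgr : IsRealCoeff (fourierRestrict (freqBall N) f) := isRealCoeff_mFourierCoeff (hf.integrable one_le_two)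
  have hw : w ∈ galerkinSubspace (freqBall N) :=
    galerkinRHS_mem ν hS hgr (fourierRestrict_coe_mem_galerkinSubspace N U)
  have hw0 : w ⟨0, zero_mem_freqBall N⟩ = 0 :=
    galerkinRHS_apply_zero ν (hf.integrable one_le_two) hf0 (fourierRestrict_coe_mem_galerkinSubspace N U)
  -- the generators are the coefficient pairings with `w`
  have hgen : ∀ p : Torus.FrameIdx (Fin 3) N, nsGeneratorPairing ν f U (Torus.frameFieldIdx N p) =
      ∑ k' ∈ freqBall N, (inner ℂ (coeffExt (freqBall N) w k') ((𝓕 (Torus.frameFieldIdx N p)) k')).re := by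
    intro p
    have hB := MomentParityQuarticGate.frameFieldIdx_band N p
    rw [nsGeneratorPairing_eq_sum_re_inner_galerkinField ν hf U hU hB.1 hB.2.1 (band_of_band₀ hB.2.2.2)]
    refine Finset.sum_congr rfl fun k' hk' => ?_
    rw [hwdef, coeffExt_of_mem _ hk', galerkinRHS_apply]
  funext k
  rw [Finset.sum_apply]
  have h := sum_sum_re_inner_smul_mFourierCoeff_frameFieldIdx hw hw0 k.2
  rw [coeffExt_coe] at h
  rw [← h]
  refine Finset.sum_congr rfl fun p _ => ?_
  rw [Pi.smul_apply, fourierRestrict_apply, hgen p, ← Complex.coe_smul]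

end Summit.AnomalousDissipation.AnomalousDissipation.Theorems.MomentParity
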